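import Summits.AtomisticToContinuum.Crystallization.Theorems.ChargedEnergyGapExcisionTails
import HarnessLib

/-!
# Charged energy gap — lens-3 g62, part P-W: PERIODIC REFOLDING of motif × points pair sums (the combinatorial frame of the charging lemma)

Cell `decomp-a2c`, seat lens-3, generation 62, part P-W (after P-V).  ELEMENTARY·PROVED, `[folklore]` bookkeeping about periodic point sets.
The localised functionals of (H𝄪ˢ) are MOTIF sums `Σ_{y ∈ F} Σ'_{z ∈ F + Λ, z ≠ y} Φ(y, z)` of a `Λ`-invariant pair weight; the charging lemma
(memo §2.3, g63 item 2) needs them read FROM THE OTHER END: `= Σ_{z ∈ F} Σ'_{y ∈ F + Λ, y ≠ z} Φ(y, z)` (each excised motif site collects the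
tension it receives, instead of each weighted site paying the tension it sends).  This file proves that refolding once and for all:
* `motifLatticeEquiv` — `F × Λ ≃ F + Λ`, `(m, g) ↦ m + g` (injective by `eq_of_sub_mem`), `tsum_points_eq_sum_tsum` — `Σ'_{F+Λ} G = Σ_{m ∈ F} Σ'_{g ∈ Λ}
  G(m + g)` and `tsum_punctured_eq` (the punctured point set as an indicator), all in `ℝ≥0∞` (no summability side conditions);
* ★★ `sum_tsum_refold` — for `Φ : E3 → E3 → ℝ≥0∞` with `Φ(y + g, z + g) = Φ(y, z)` (`g ∈ Λ`):
  `Σ_{y ∈ F} Σ'_{z ≠ y} Φ(y, z) = Σ_{z ∈ F} Σ'_{y ≠ z} Φ(y, z)`; ★ `sum_tsum_refold_real` — the same for a non-negative real `Φ` with both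
  families summable;
* `profileWeight_add_of_isInvariantSet`, `localFactor_add_of_isInvariantSet` — the (H𝄪ˢ) weights are `Λ`-periodic for invariant `C`, `Dᵢ`;
* ★★ `excisionMassL_refold` — `excisionMassL = Σ_{z ∈ F ∩ X} Σ'_{y ∈ (F+Λ) ∖ X, y ≠ z} χ_σ(y)·w_C(y)·(V′(d_yz))⁺·d_yz` for invariant `X, C, Dᵢ`:
  the excision mass as a sum over EXCISED MOTIF SITES of received tension — the form in which P-V's tail bounds (`Σ'_{y : d > 1} d⁻⁶ ≤ 1024/s³`
  per excised site, `≤ 1024/(s³R³)` beyond `R`) and P-S's ball counts charge it to `pricedNearCountL` (near pairs) and to the boundary layer (far).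
-/

noncomputable section

open scoped Classical ENNReal

open Literature.MathematicalPhysics.StatisticalMechanics Literature.Geometry.DiscreteGeometry
open Summit.AtomisticToContinuum.Crystallization.Theses.PricedLinkCensus
open Summit.AtomisticToContinuum.Crystallization.Theorems.ChargedEnergyGapNegative

namespace Summit.AtomisticToContinuum.Crystallization.Theorems.ChargedEnergyGapChartDial

section Refolding

variable (P : PeriodicConfiguration 3)

/-- `(m, g) ↦ m + g` is injective on `F × Λ` (motif sites are pairwise inequivalent modulo `Λ`). -/
theorem motif_add_lattice_injective {m m' g g' : E3} (hm : m ∈ P.motif) (hm' : m' ∈ P.motif) (hg : g ∈ P.lattice) (hg' : g' ∈ P.lattice)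
    (h : m + g = m' + g') : m = m' ∧ g = g' := by
  have hmm' : m - m' = g' - g := by rw [eq_sub_of_add_eq h]; abel
  have hsub : m - m' ∈ P.lattice := by
    rw [hmm']
    exact P.lattice.sub_mem hg' hg
  have hmm : m = m' := P.eq_of_sub_mem _ hm _ hm' hsub
  subst hmm
  exact ⟨rfl, add_left_cancel h⟩

/-- ★ `F × Λ ≃ F + Λ`, `(m, g) ↦ m + g`. -/
def motifLatticeEquiv : (P.motif × P.lattice) ≃ P.points :=
  Equiv.ofBijective
    (fun q : P.motif × P.lattice => (⟨(q.1 : E3) + (q.2 : E3), (q.1 : E3), q.1.2, (q.2 : E3), q.2.2, rfl⟩ : P.points))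
    (by
      constructor
      · rintro ⟨m, g⟩ ⟨m', g'⟩ h
        have h' : (m : E3) + (g : E3) = (m' : E3) + (g' : E3) := congrArg Subtype.val h
        obtain ⟨hm, hg⟩ := motif_add_lattice_injective P m.2 m'.2 g.2 g'.2 h'
        exact Prod.ext (Subtype.ext hm) (Subtype.ext hg)
      · rintro ⟨z, y, hy, g, hg, rfl⟩
        exact ⟨(⟨y, hy⟩, ⟨g, hg⟩), rfl⟩)

/-- `motifLatticeEquiv_apply` (docstring added by the landing lane; see the module docstring). [formal bookkeeping] -/
@[simp] theorem motifLatticeEquiv_apply (q : P.motif × P.lattice) : ((motifLatticeEquiv P q : P.points) : E3) = (q.1 : E3) + (q.2 : E3) :=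
  rfl

/-- ★ `Σ'_{z ∈ F + Λ} G(z) = Σ_{m ∈ F} Σ'_{g ∈ Λ} G(m + g)` in `ℝ≥0∞`. -/
theorem tsum_points_eq_sum_tsum (G : E3 → ℝ≥0∞) : ∑' z : P.points, G z = ∑ m ∈ P.motif, ∑' g : P.lattice, G (m + (g : E3)) := by
  rw [← (motifLatticeEquiv P).tsum_eq, ENNReal.tsum_prod']
  simp only [motifLatticeEquiv_apply]
  rw [tsum_fintype]
  exact Finset.sum_coe_sort P.motif (fun m => ∑' g : P.lattice, G (m + (g : E3)))

/-- The punctured point set as an indicator: `Σ'_{z ∈ S, z ≠ y} f(z) = Σ'_{z ∈ S} [z ≠ y]·f(z)` in `ℝ≥0∞`. -/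
theorem tsum_punctured_eq (S : Set E3) (y : E3) (f : E3 → ℝ≥0∞) :
    ∑' z : {z : E3 // z ∈ S ∧ z ≠ y}, f z = ∑' z : S, (if (z : E3) = y then 0 else f z) := by
  rw [tsum_subtype S (fun z => if z = y then 0 else f z)]
  have h : (∑' z : {z : E3 // z ∈ S ∧ z ≠ y}, f z) = ∑' z : E3, ({z | z ∈ S ∧ z ≠ y}).indicator f z := tsum_subtype {z | z ∈ S ∧ z ≠ y} f
  rw [h]
  refine tsum_congr fun z => ?_
  simp only [Set.indicator_apply, Set.mem_setOf_eq]
  by_cases hz : z ∈ S <;> by_cases hzy : z = y <;> simp [hz, hzy]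

/-- One end of a motif pair sum, unfolded over `F × Λ`. -/
theorem tsum_punctured_points_eq (y : E3) (G : E3 → ℝ≥0∞) :
    ∑' z : {z : E3 // z ∈ P.points ∧ z ≠ y}, G z = ∑ m ∈ P.motif, ∑' g : P.lattice, (if m + (g : E3) = y then 0 else G (m + (g : E3))) := by
  rw [tsum_punctured_eq]
  exact tsum_points_eq_sum_tsum P (fun z => if z = y then 0 else G z)

/-- ★★ **PERIODIC REFOLDING** (`ℝ≥0∞`): for a `Λ`-invariant pair weight, the motif sum of the sums over all other points can be read from
either end: `Σ_{y ∈ F} Σ'_{z ≠ y} Φ(y, z) = Σ_{z ∈ F} Σ'_{y ≠ z} Φ(y, z)`. -/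
theorem sum_tsum_refold (Φ : E3 → E3 → ℝ≥0∞) (hΦ : ∀ g ∈ P.lattice, ∀ y z : E3, Φ (y + g) (z + g) = Φ y z) :
    ∑ y ∈ P.motif, ∑' z : {z : E3 // z ∈ P.points ∧ z ≠ y}, Φ y z =
      ∑ z ∈ P.motif, ∑' y : {y : E3 // y ∈ P.points ∧ y ≠ z}, Φ y z := by
  rw [Finset.sum_congr rfl fun y _ => tsum_punctured_points_eq P y (fun z => Φ y z),
    Finset.sum_congr rfl fun z _ => tsum_punctured_points_eq P z (fun y => Φ y z), Finset.sum_comm]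
  refine Finset.sum_congr rfl fun m _ => Finset.sum_congr rfl fun y _ => ?_
  rw [← (Equiv.neg P.lattice).tsum_eq]
  refine tsum_congr fun g => ?_
  simp only [Equiv.neg_apply, Submodule.coe_neg]
  have h1 : m + -(g : E3) = y ↔ y + (g : E3) = m := by
    constructor
    · intro h; rw [← h, neg_add_cancel_right]
    · intro h; rw [← h, add_neg_cancel_right]
  have h2 : Φ y (m + -(g : E3)) = Φ (y + (g : E3)) m := by
    have h := hΦ (g : E3) g.2 y (m + -(g : E3))
    rw [neg_add_cancel_right] at h
    exact h.symm
  by_cases h : y + (g : E3) = m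
  · rw [if_pos h, if_pos (h1.2 h)]
  · rw [if_neg h, if_neg (fun h' => h (h1.1 h')), h2]

/-- ★ **PERIODIC REFOLDING** (real, non-negative, both families summable). -/
theorem sum_tsum_refold_real (Φ : E3 → E3 → ℝ) (h0 : ∀ y z, 0 ≤ Φ y z) (hΦ : ∀ g ∈ P.lattice, ∀ y z : E3, Φ (y + g) (z + g) = Φ y z)
    (h1 : ∀ y ∈ P.motif, Summable fun z : {z : E3 // z ∈ P.points ∧ z ≠ y} => Φ y z)
    (h2 : ∀ z ∈ P.motif, Summable fun y : {y : E3 // y ∈ P.points ∧ y ≠ z} => Φ y z) :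
    ∑ y ∈ P.motif, ∑' z : {z : E3 // z ∈ P.points ∧ z ≠ y}, Φ y z =
      ∑ z ∈ P.motif, ∑' y : {y : E3 // y ∈ P.points ∧ y ≠ z}, Φ y z := by
  have key := sum_tsum_refold P (fun y z => ENNReal.ofReal (Φ y z)) (fun g hg y z => by simp only [hΦ g hg y z])
  have hl : ENNReal.ofReal (∑ y ∈ P.motif, ∑' z : {z : E3 // z ∈ P.points ∧ z ≠ y}, Φ y z) =
      ∑ y ∈ P.motif, ∑' z : {z : E3 // z ∈ P.points ∧ z ≠ y}, ENNReal.ofReal (Φ y z) := by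
    rw [ENNReal.ofReal_sum_of_nonneg (fun y _ => tsum_nonneg fun z : {z : E3 // z ∈ P.points ∧ z ≠ y} => h0 y z)]
    exact Finset.sum_congr rfl fun y hy =>
      ENNReal.ofReal_tsum_of_nonneg (fun z : {z : E3 // z ∈ P.points ∧ z ≠ y} => h0 y z) (h1 y hy)
  have hr : ENNReal.ofReal (∑ z ∈ P.motif, ∑' y : {y : E3 // y ∈ P.points ∧ y ≠ z}, Φ y z) =
      ∑ z ∈ P.motif, ∑' y : {y : E3 // y ∈ P.points ∧ y ≠ z}, ENNReal.ofReal (Φ y z) := by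
    rw [ENNReal.ofReal_sum_of_nonneg (fun z _ => tsum_nonneg fun y : {y : E3 // y ∈ P.points ∧ y ≠ z} => h0 y z)]
    exact Finset.sum_congr rfl fun z hz =>
      ENNReal.ofReal_tsum_of_nonneg (fun y : {y : E3 // y ∈ P.points ∧ y ≠ z} => h0 y z) (h2 z hz)
  have h := hl.trans (key.trans hr.symm)
  exact (ENNReal.ofReal_eq_ofReal_iff
    (Finset.sum_nonneg fun y _ => tsum_nonneg fun z : {z : E3 // z ∈ P.points ∧ z ≠ y} => h0 y z)
    (Finset.sum_nonneg fun z _ => tsum_nonneg fun y : {y : E3 // y ∈ P.points ∧ y ≠ z} => h0 y z)).1 h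

end Refolding

section WeightPeriodicity

variable {P : PeriodicConfiguration 3}

/-- An invariant set is its own translate by a period. -/
theorem IsInvariantSet.image_add_eq {C : Set E3} (hC : IsInvariantSet P C) {g : E3} (hg : g ∈ P.lattice) : (fun q => q + g) '' C = C := by
  ext z
  constructor
  · rintro ⟨q, hq, rfl⟩
    exact (hC g hg q).2 hq
  · intro hz
    exact ⟨z - g, (hC g hg (z - g)).1 (by rwa [sub_add_cancel]), sub_add_cancel z g⟩

/-- The distance to an invariant set is periodic … -/
theorem IsInvariantSet.infDist_add {C : Set E3} (hC : IsInvariantSet P C) {g : E3} (hg : g ∈ P.lattice) (q : E3) :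
    Metric.infDist (q + g) C = Metric.infDist q C := by
  conv_lhs => rw [← hC.image_add_eq hg]
  exact Metric.infDist_image (Isometry.of_dist_eq fun a b => dist_add_right a b g)

/-- … hence so is the profile weight of an invariant centre set … -/
theorem profileWeight_add_of_isInvariantSet (ϱ : ℝ) {C : Set E3} (hC : IsInvariantSet P C) {g : E3} (hg : g ∈ P.lattice) (q : E3) :
    profileWeight ϱ C (q + g) = profileWeight ϱ C q := by
  unfold profileWeight
  rw [hC.infDist_add hg]

/-- … and the localisation factor of an invariant set list. -/
theorem localFactor_add_of_isInvariantSet (ϱχ : ℝ) {m : ℕ} {D : Fin m → Set E3} (hD : ∀ i, IsInvariantSet P (D i)) (σ : Fin m → Bool)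
    {g : E3} (hg : g ∈ P.lattice) (y : E3) : localFactor ϱχ D σ (y + g) = localFactor ϱχ D σ y := by
  unfold localFactor
  exact Finset.prod_congr rfl fun i _ => by rw [profileWeight_add_of_isInvariantSet ϱχ (hD i) hg]

end WeightPeriodicity

section ExcisionRefold

variable (ϱχ : ℝ) {m : ℕ} (D : Fin m → Set E3) (σ : Fin m → Bool) (P : PeriodicConfiguration 3) (X : Set E3) (ϱ : ℝ) (C : Set E3)

/-- The RECEIVED TENSION of an excised site `z`: `Σ'_{y ∈ (F+Λ) ∖ X, y ≠ z} χ_σ(y)·w_C(y)·(V′(d_yz))⁺·d_yz`. -/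
def receivedTension (z : E3) : ℝ :=
  ∑' y : {y : E3 // y ∈ P.points ∧ y ≠ z},
    if (y : E3) ∈ X then 0 else localFactor ϱχ D σ y * profileWeight ϱ C y * (max (ljD1 (dist (y : E3) z)) 0 * dist (y : E3) z)

/-- Its summand is non-negative and dominated by the (full) excision summand AT `z`, hence summable. -/
theorem receivedTension_summand_nonneg (z : E3) (y : {y : E3 // y ∈ P.points ∧ y ≠ z}) :
    0 ≤ (if (y : E3) ∈ X then 0 else localFactor ϱχ D σ y * profileWeight ϱ C y * (max (ljD1 (dist (y : E3) z)) 0 * dist (y : E3) z)) := by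
  split_ifs
  · exact le_rfl
  · exact mul_nonneg (mul_nonneg (localFactor_nonneg (ϱχ := ϱχ) (D := D) (σ := σ) y) (profileWeight_nonneg ϱ C y))
      (mul_nonneg (le_max_right _ _) dist_nonneg)

/-- The UNIVERSAL tension sum at `z` written without its (trivial) indicator. [formal bookkeeping] -/
theorem excisionSum_univ_eq (z : E3) :
    excisionSum P Set.univ z = ∑' y : {y : E3 // y ∈ P.points ∧ y ≠ z}, max (ljD1 (dist z y)) 0 * dist z (y : E3) := by
  unfold excisionSum
  exact tsum_congr fun y => by simp

/-- `summable_tension`: the universal tension summand is summable (P-P). [formal bookkeeping] -/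
theorem summable_tension (z : E3) : Summable fun y : {y : E3 // y ∈ P.points ∧ y ≠ z} => max (ljD1 (dist z y)) 0 * dist z (y : E3) :=
  (summable_excisionSummand P Set.univ z).congr fun y => by simp

/-- `receivedTension_summand_le`: domination by the universal tension summand at `z` (weights `≤ 1`). [formal bookkeeping] -/
theorem receivedTension_summand_le (z : E3) (y : {y : E3 // y ∈ P.points ∧ y ≠ z}) :
    (if (y : E3) ∈ X then 0 else localFactor ϱχ D σ y * profileWeight ϱ C y * (max (ljD1 (dist (y : E3) z)) 0 * dist (y : E3) z)) ≤
      max (ljD1 (dist z y)) 0 * dist z (y : E3) := by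
  rw [dist_comm z (y : E3)]
  have hT : 0 ≤ max (ljD1 (dist (y : E3) z)) 0 * dist (y : E3) z := mul_nonneg (le_max_right _ _) dist_nonneg
  split_ifs
  · exact hT
  · have hχ := localFactor_nonneg (ϱχ := ϱχ) (D := D) (σ := σ) (y : E3)
    have hχ1 := localFactor_le_one (ϱχ := ϱχ) (D := D) (σ := σ) (y : E3)
    have hw := profileWeight_nonneg ϱ C y
    have hw1 := profileWeight_le_one ϱ C y
    calc localFactor ϱχ D σ y * profileWeight ϱ C y * (max (ljD1 (dist (y : E3) z)) 0 * dist (y : E3) z)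
        ≤ 1 * 1 * (max (ljD1 (dist (y : E3) z)) 0 * dist (y : E3) z) := by gcongr
      _ = _ := by ring

/-- `summable_receivedTension_summand`. [formal bookkeeping] -/
theorem summable_receivedTension_summand (z : E3) :
    Summable fun y : {y : E3 // y ∈ P.points ∧ y ≠ z} =>
      (if (y : E3) ∈ X then 0 else localFactor ϱχ D σ y * profileWeight ϱ C y * (max (ljD1 (dist (y : E3) z)) 0 * dist (y : E3) z)) :=
  Summable.of_nonneg_of_le (receivedTension_summand_nonneg ϱχ D σ P X ϱ C z) (receivedTension_summand_le ϱχ D σ P X ϱ C z)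
    (summable_tension P z)

/-- `receivedTension_nonneg`. [formal bookkeeping] -/
theorem receivedTension_nonneg (z : E3) : 0 ≤ receivedTension ϱχ D σ P X ϱ C z :=
  tsum_nonneg (receivedTension_summand_nonneg ϱχ D σ P X ϱ C z)

/-- ★ The received tension of `z` is at most the UNIVERSAL tension sum `E_univ(z) = Σ'_{y ≠ z} (V′(d))⁺·d` at `z` (weights `≤ 1`) — to which
P-V's `excisionSum_le_uniform` / `excisionSum_le_far` apply verbatim. -/
theorem receivedTension_le_excisionSum_univ (z : E3) : receivedTension ϱχ D σ P X ϱ C z ≤ excisionSum P Set.univ z := by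
  rw [excisionSum_univ_eq]
  exact Summable.tsum_le_tsum (receivedTension_summand_le ϱχ D σ P X ϱ C z) (summable_receivedTension_summand ϱχ D σ P X ϱ C z)
    (summable_tension P z)

variable {P X C D}

/-- ★★ **THE EXCISION MASS REFOLDED**: for invariant `X`, `C`, `Dᵢ`, the localised excision mass is the sum over the EXCISED MOTIF SITES of
their received tensions: `excisionMassL = Σ_{z ∈ F ∩ X} receivedTension(z)`. -/
theorem excisionMassL_refold (hX : IsInvariantSet P X) (hC : IsInvariantSet P C) (hD : ∀ i, IsInvariantSet P (D i)) :
    excisionMassL ϱχ D σ P X ϱ C = ∑ z ∈ P.motif, if z ∈ X then receivedTension ϱχ D σ P X ϱ C z else 0 := by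
  -- the invariant pair weight
  set Φ : E3 → E3 → ℝ := fun y z =>
    (if y ∈ X then 0 else localFactor ϱχ D σ y * profileWeight ϱ C y) * (if z ∈ X then max (ljD1 (dist y z)) 0 * dist y z else 0) with hΦdef
  have h0 : ∀ y z, 0 ≤ Φ y z := fun y z => by
    simp only [hΦdef]
    refine mul_nonneg ?_ ?_
    · split_ifs
      · exact le_rfl
      · exact mul_nonneg (localFactor_nonneg (ϱχ := ϱχ) (D := D) (σ := σ) y) (profileWeight_nonneg ϱ C y)
    · split_ifs
      · exact mul_nonneg (le_max_right _ _) dist_nonneg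
      · exact le_rfl
  have hΦ : ∀ g ∈ P.lattice, ∀ y z : E3, Φ (y + g) (z + g) = Φ y z := fun g hg y z => by
    simp only [hΦdef, hX g hg, localFactor_add_of_isInvariantSet ϱχ hD σ hg, profileWeight_add_of_isInvariantSet ϱ hC hg, dist_add_right]
  -- left end: the excision mass
  have hL : excisionMassL ϱχ D σ P X ϱ C = ∑ y ∈ P.motif, ∑' z : {z : E3 // z ∈ P.points ∧ z ≠ y}, Φ y z := by
    unfold excisionMassL excisionSum
    refine Finset.sum_congr rfl fun y _ => ?_
    simp only [hΦdef]
    rw [tsum_mul_left]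
    split_ifs <;> ring
  -- right end: the received tensions
  have hR : (∑ z ∈ P.motif, if z ∈ X then receivedTension ϱχ D σ P X ϱ C z else 0) =
      ∑ z ∈ P.motif, ∑' y : {y : E3 // y ∈ P.points ∧ y ≠ z}, Φ y z := by
    refine Finset.sum_congr rfl fun z _ => ?_
    by_cases hz : z ∈ X
    · rw [if_pos hz, receivedTension]
      refine tsum_congr fun y => ?_
      simp only [hΦdef, if_pos hz]
      split_ifs <;> ring
    · rw [if_neg hz]
      symm
      refine (tsum_congr fun y => ?_).trans tsum_zero
      simp only [hΦdef, if_neg hz, mul_zero]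
  -- summability of both families
  have h1 : ∀ y ∈ P.motif, Summable fun z : {z : E3 // z ∈ P.points ∧ z ≠ y} => Φ y z := fun y _ => by
    simp only [hΦdef]
    exact (summable_excisionSummand P X y).mul_left _
  have h2 : ∀ z ∈ P.motif, Summable fun y : {y : E3 // y ∈ P.points ∧ y ≠ z} => Φ y z := fun z _ => by
    by_cases hz : z ∈ X
    · have hs := summable_receivedTension_summand ϱχ D σ P X ϱ C z
      refine (hs.congr fun y => ?_)
      simp only [hΦdef, if_pos hz]
      split_ifs <;> ring
    · refine (summable_zero.congr fun y => ?_)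
      simp only [hΦdef, if_neg hz, mul_zero]
  rw [hL, hR]
  exact sum_tsum_refold_real P Φ h0 hΦ h1 h2

/-- ★ COROLLARY (the frame of the charging lemma): for invariant data and an `s`-separated reference (`0 < s ≤ 1`),
`excisionMassL ≤ Σ_{z ∈ F ∩ X} E_univ(z) ≤ (1024/s³)·#(F ∩ X)` — every unit of excision mass is RECEIVED by an excised motif site, and each
receives at most P-V's uniform constant (the near/far refinement by `excisionSum_le_far` is g63's). -/
theorem excisionMassL_le_sum_excised (hX : IsInvariantSet P X) (hC : IsInvariantSet P C) (hD : ∀ i, IsInvariantSet P (D i)) :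
    excisionMassL ϱχ D σ P X ϱ C ≤ ∑ z ∈ P.motif, if z ∈ X then excisionSum P Set.univ z else 0 := by
  rw [excisionMassL_refold ϱχ σ ϱ hX hC hD]
  refine Finset.sum_le_sum fun z _ => ?_
  split_ifs
  · exact receivedTension_le_excisionSum_univ ϱχ D σ P X ϱ C z
  · exact le_rfl

end ExcisionRefold

end Summit.AtomisticToContinuum.Crystallization.Theorems.ChargedEnergyGapChartDial
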